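import Mathlib.AlgebraicGeometry.Morphisms.Separated
import Mathlib.AlgebraicGeometry.Morphisms.Immersion
import Literature.AlgebraicGeometry.Limits.PushoutOpenImmersion
import HarnessLib

/-!
# Separatedness of a scheme glued from two separated pieces along an open

Topic: `Literature/AlgebraicGeometry/Morphisms`. The gluing criterion from the introduction of
Conrad's exposition of Deligne's notes on Nagata compactifications (B. Conrad, *Deligne's notes
on Nagata compactifications*, J. Ramanujan Math. Soc. 22 (2007), Introduction, "Guide to the
proof", p. 207 of the journal = p. 3 of the author's pdf):

> "Recall that for any scheme `S`, if we glue two separated `S`-schemes `T₁` and `T₂` along an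
> `S`-isomorphism `ι : V₁ ≃ V₂` between open subschemes, then the resulting `S`-scheme `T` is
> separated if and only if the subscheme graph `Γ_ι ⊆ T₁ ×_S T₂` of `ι` is closed. [...] observe
> that `{Tᵢ ×_S Tⱼ}` is an open covering of `T ×_S T` and the intersection of `Δ_{T/S}` with the
> elements of this covering are `Δ_{T₁/S}`, `Δ_{T₂/S}`, `Γ_ι`, and `Γ_{ι⁻¹}`. Since closedness
> can be checked over an open covering of a topological space, we see the assertion."

This is the device by which separatedness is maintained in the gluing steps of the proof of
Nagata's theorem (Conrad 2007, proof of Thm. 4.1: the schemes `Mᵢ`; Thm. 2.8). In Mathlib's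
language the gluing of `Z₁` and `Z₂` along open immersions `f : W → Z₁`, `g : W → Z₂` is the
push-out `Z₁ ⨿_W Z₂` (`pushout f g`, a locally directed colimit of open immersions; the charts
`pushout.inl`, `pushout.inr` are open immersions, `Literature/AlgebraicGeometry/Limits/PushoutOpenImmersion`),
a morphism `p : Z₁ ⨿_W Z₂ → S` is the same as a compatible pair `p₁, p₂`, and the graph of the
gluing isomorphism is the morphism `(f, g)_S : W → Z₁ ×_S Z₂` (`pullback.lift f g _`).

## Main results (all proved; no named facts)

* `isPullback_inl_inr` — the push-out square of two open immersions is cartesian: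
  `W = Z₁ ×_{Z₁ ⨿_W Z₂} Z₂`.
* `isClosedImmersion_pullbackLift_iff_isClosed_range` — the graph `W → Z₁ ×_S Z₂` is an
  immersion as soon as `f` is, so it is a closed immersion iff its image is closed.
* `isSeparated_iff_isClosedImmersion_graph`, `isSeparated_iff_isClosed_range_graph` — **Conrad's
  criterion**: for `p : Z₁ ⨿_W Z₂ → S` with `Z₁ → S`, `Z₂ → S` separated, `p` is separated iff the
  graph `W → Z₁ ×_S Z₂` is a closed immersion iff it has closed image;
  `isSeparated_pushoutDesc_iff`, `isSeparated_pushoutDesc_iff_isClosed_range`,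
  `isSeparated_pushoutDesc` — the same for `p = pushout.desc p₁ p₂ _`.

## References

* B. Conrad, *Deligne's notes on Nagata compactifications*, J. Ramanujan Math. Soc. 22 (2007)
  205–257, Introduction. [Conrad2007]
* The Stacks Project, Tag 01KR (Schemes, Lemma 26.21.11: `g ∘ f` an immersion ⇒ `f` an
  immersion), Tag 01JA ff. (gluing schemes). [StacksProject]
-/

noncomputable section

-- Mathlib's pull-back API (`pullback.lift_fst`, `pullback.map`, …) is stated through `abbrev`s
-- over `limit`; as in Mathlib's own algebraic-geometry files we let `simp`/unification see
-- through them.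
set_option backward.isDefEq.respectTransparency false

universe u

open CategoryTheory CategoryTheory.Limits AlgebraicGeometry TopologicalSpace

namespace Literature.AlgebraicGeometry.Morphisms

variable {W Z₁ Z₂ : Scheme.{u}} (f : W ⟶ Z₁) (g : W ⟶ Z₂)

/-! ## The graph of a pair of morphisms over `S` -/

section Graph

variable {S : Scheme.{u}} (p₁ : Z₁ ⟶ S) (p₂ : Z₂ ⟶ S) (w : f ≫ p₁ = g ≫ p₂)

/-- The graph `(f, g)_S : W → Z₁ ×_S Z₂` is an immersion as soon as `f` is: its composite with
the first projection is `f` (Stacks 01KR: if `g ∘ f` is an immersion then so is `f`).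
[folklore] -/
theorem isImmersion_pullbackLift [IsImmersion f] : IsImmersion (pullback.lift f g w) := by
  haveI : IsImmersion (pullback.lift f g w ≫ pullback.fst p₁ p₂) := by
    rw [pullback.lift_fst]; infer_instance
  exact .of_comp _ (pullback.fst p₁ p₂)

/-- For `f` an immersion, the graph `W → Z₁ ×_S Z₂` is a closed immersion iff its image is closed
(an immersion with closed image is a closed immersion). [folklore] -/
theorem isClosedImmersion_pullbackLift_iff_isClosed_range [IsImmersion f] :
    IsClosedImmersion (pullback.lift f g w) ↔
      IsClosed (Set.range (pullback.lift f g w : W ⟶ pullback p₁ p₂)) := by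
  refine ⟨fun h ↦ (pullback.lift f g w).isClosedEmbedding.isClosed_range, fun h ↦ ?_⟩
  haveI := isImmersion_pullbackLift f g p₁ p₂ w
  exact .of_isPreimmersion _ h

end Graph

-- From here on `f` and `g` are open immersions: Mathlib has push-outs of schemes along open
-- immersions (locally directed colimits), not in general.
variable [IsOpenImmersion f] [IsOpenImmersion g]

/-! ## Charts of the self-product of a push-out -/

section Charts

variable {S : Scheme.{u}} (p : pushout f g ⟶ S)

/-- The graph of the gluing over `S`, for a morphism `p : Z₁ ⨿_W Z₂ → S`:
`W → Z₁ ×_S Z₂` with components `f` and `g`. [folklore] -/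
abbrev pushoutGraph : W ⟶ pullback (pushout.inl f g ≫ p) (pushout.inr f g ≫ p) :=
  pullback.lift f g (by rw [pushout.condition_assoc])

/-- The chart `A ×_S B → (Z₁ ⨿_W Z₂) ×_S (Z₁ ⨿_W Z₂)` of the self-product of the gluing given by
two morphisms `a : A → Z₁ ⨿_W Z₂`, `b : B → Z₁ ⨿_W Z₂` (used with the two charts `inl`, `inr`).
[folklore] -/
abbrev pushoutChart {A B : Scheme.{u}} (a : A ⟶ pushout f g) (b : B ⟶ pushout f g) :
    pullback (a ≫ p) (b ≫ p) ⟶ pullback p p :=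
  pullback.map (a ≫ p) (b ≫ p) p p a b (𝟙 S) (Category.comp_id _) (Category.comp_id _)

/-- The diagonal of `Z₁ ⨿_W Z₂ → S` pulled back to the chart `A ×_S B`:
`A ×_{Z₁ ⨿_W Z₂} B → A ×_S B`. [folklore] -/
abbrev pushoutDiagonalChart {A B : Scheme.{u}} (a : A ⟶ pushout f g) (b : B ⟶ pushout f g) :
    pullback a b ⟶ pullback (a ≫ p) (b ≫ p) :=
  pullback.map a b (a ≫ p) (b ≫ p) (𝟙 A) (𝟙 B) p (Category.id_comp _).symm
    (Category.id_comp _).symm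

/-- Over the chart `A ×_S B` the diagonal of `p` pulls back to `A ×_{Z₁ ⨿_W Z₂} B → A ×_S B`
(Mathlib `pullback_map_diagonal_isPullback`), so being a closed immersion there is the same for
the two maps. [folklore] -/
theorem isClosedImmersion_pullbackSnd_diagonal_chart_iff {A B : Scheme.{u}}
    (a : A ⟶ pushout f g) (b : B ⟶ pushout f g) :
    IsClosedImmersion (pullback.snd (pullback.diagonal p) (pushoutChart f g p a b)) ↔
      IsClosedImmersion (pushoutDiagonalChart f g p a b) := by
  have H := pullback_map_diagonal_isPullback a b p
  rw [← H.isoPullback_inv_snd]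
  exact MorphismProperty.cancel_left_of_respectsIso @IsClosedImmersion _ _

/-- On a chart `A ×_S A` with `a : A → Z₁ ⨿_W Z₂` a monomorphism, the restricted diagonal is the
diagonal of `A → S` (up to the isomorphism `A ×_{Z₁ ⨿_W Z₂} A ≅ A`). [folklore] -/
theorem pushoutDiagonalChart_self {A : Scheme.{u}} (a : A ⟶ pushout f g) [Mono a] :
    pushoutDiagonalChart f g p a a = pullback.fst a a ≫ pullback.diagonal (a ≫ p) := by
  ext
  · simp
  · simp [fst_eq_snd_of_mono_eq]

/-- On the mixed chart `Z₁ ×_S Z₂` the restricted diagonal, composed with the comparison map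
`W → Z₁ ×_{Z₁ ⨿_W Z₂} Z₂`, is the graph of the gluing. [folklore] -/
theorem pullbackLift_pushoutDiagonalChart :
    pullback.lift f g pushout.condition ≫ pushoutDiagonalChart f g p (pushout.inl f g) (pushout.inr f g) =
      pushoutGraph f g p := by
  ext <;> simp

/-- The mixed chart the other way round gives the graph followed by the symmetry of the fibre
product. [folklore] -/
theorem pullbackLift_pushoutDiagonalChart' :
    pullback.lift g f pushout.condition.symm ≫
        pushoutDiagonalChart f g p (pushout.inr f g) (pushout.inl f g) =
      pushoutGraph f g p ≫ (pullbackSymmetry _ _).hom := by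
  ext <;> simp

end Charts

/-! ## The push-out square of open immersions is cartesian -/

/-- The comparison map `W → Z₁ ×_{Z₁ ⨿_W Z₂} Z₂` is an isomorphism: it is an open immersion
(its composite with the open immersion `pr₁` is the open immersion `f`) and it is surjective
(the two charts of the push-out meet exactly in `W`,
`Literature.AlgebraicGeometry.Limits.exists_eq_of_inl_eq_inr`). [folklore] -/
theorem isIso_pullbackLift_inl_inr :
    IsIso (pullback.lift f g pushout.condition :
      W ⟶ pullback (pushout.inl f g) (pushout.inr f g)) := by
  haveI := Limits.isOpenImmersion_inl f g
  haveI := Limits.isOpenImmersion_inr f g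
  haveI : IsOpenImmersion ((pullback.lift f g pushout.condition :
      W ⟶ pullback (pushout.inl f g) (pushout.inr f g)) ≫
        pullback.fst (pushout.inl f g) (pushout.inr f g)) := by
    rw [pullback.lift_fst]; infer_instance
  haveI : IsOpenImmersion (pullback.lift f g pushout.condition :
      W ⟶ pullback (pushout.inl f g) (pushout.inr f g)) :=
    .of_comp _ (pullback.fst (pushout.inl f g) (pushout.inr f g))
  rw [isIso_iff_isOpenImmersion_and_surjective]
  refine ⟨inferInstance, ⟨fun z ↦ ?_⟩⟩
  obtain ⟨w, hw₁, -⟩ := Limits.exists_eq_of_inl_eq_inr f g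
    (pullback.fst (pushout.inl f g) (pushout.inr f g) z)
    (pullback.snd (pushout.inl f g) (pushout.inr f g) z)
    (by simp only [← Scheme.Hom.comp_apply, pullback.condition])
  refine ⟨w, (pullback.fst (pushout.inl f g) (pushout.inr f g)).isOpenEmbedding.injective ?_⟩
  rw [← Scheme.Hom.comp_apply, pullback.lift_fst, hw₁]

/-- The transposed comparison map `W → Z₂ ×_{Z₁ ⨿_W Z₂} Z₁` is an isomorphism as well.
[folklore] -/
theorem isIso_pullbackLift_inr_inl :
    IsIso (pullback.lift g f pushout.condition.symm :
      W ⟶ pullback (pushout.inr f g) (pushout.inl f g)) := by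
  have : (pullback.lift g f pushout.condition.symm :
      W ⟶ pullback (pushout.inr f g) (pushout.inl f g)) =
      pullback.lift f g pushout.condition ≫ (pullbackSymmetry _ _).hom := by
    ext <;> simp
  rw [this]
  haveI := isIso_pullbackLift_inl_inr f g
  infer_instance

/-- **The push-out square of two open immersions is cartesian**: `W ≅ Z₁ ×_{Z₁ ⨿_W Z₂} Z₂`
(the glued charts intersect exactly in the open along which they were glued; Stacks 01JB).
[folklore] -/
theorem isPullback_inl_inr : IsPullback f g (pushout.inl f g) (pushout.inr f g) :=
  haveI := isIso_pullbackLift_inl_inr f g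
  IsPullback.of_iso_pullback ⟨pushout.condition⟩ (asIso (pullback.lift f g pushout.condition))
    (pullback.lift_fst _ _ _) (pullback.lift_snd _ _ _)

/-! ## Conrad's criterion -/

section Criterion

variable {S : Scheme.{u}} (p : pushout f g ⟶ S)

/-- The four charts `Zᵢ ×_S Zⱼ → (Z₁ ⨿_W Z₂) ×_S (Z₁ ⨿_W Z₂)` cover the self-product.
[folklore] -/
theorem exists_pushoutChart_eq (x : ↑(pullback p p)) :
    (∃ y, pushoutChart f g p (pushout.inl f g) (pushout.inl f g) y = x) ∨
    (∃ y, pushoutChart f g p (pushout.inl f g) (pushout.inr f g) y = x) ∨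
    (∃ y, pushoutChart f g p (pushout.inr f g) (pushout.inl f g) y = x) ∨
    (∃ y, pushoutChart f g p (pushout.inr f g) (pushout.inr f g) y = x) := by
  have key : ∀ {A B : Scheme.{u}} (a : A ⟶ pushout f g) (b : B ⟶ pushout f g),
      pullback.fst p p x ∈ Set.range a → pullback.snd p p x ∈ Set.range b →
        ∃ y, pushoutChart f g p a b y = x := by
    intro A B a b ha hb
    show x ∈ Set.range (pushoutChart f g p a b)
    rw [Scheme.Pullback.range_map]
    exact ⟨ha, hb⟩
  have hx₁ := (Set.eq_univ_iff_forall.mp (Limits.range_inl_union_range_inr f g))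
    (pullback.fst p p x)
  have hx₂ := (Set.eq_univ_iff_forall.mp (Limits.range_inl_union_range_inr f g))
    (pullback.snd p p x)
  rcases hx₁ with h₁ | h₁ <;> rcases hx₂ with h₂ | h₂
  · exact .inl (key _ _ h₁ h₂)
  · exact .inr (.inl (key _ _ h₁ h₂))
  · exact .inr (.inr (.inl (key _ _ h₁ h₂)))
  · exact .inr (.inr (.inr (key _ _ h₁ h₂)))

/-- **Conrad's gluing criterion for separatedness** (Conrad 2007, Introduction, p. 3: "if we glue
two separated `S`-schemes `T₁` and `T₂` along an `S`-isomorphism between open subschemes, then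
the resulting `S`-scheme `T` is separated if and only if the subscheme graph `Γ_ι ⊆ T₁ ×_S T₂`
is closed"), closed-immersion form: for `p : Z₁ ⨿_W Z₂ → S` whose restrictions to the two charts
are separated, `p` is separated iff the graph `W → Z₁ ×_S Z₂` is a closed immersion. Proof as
printed: the four charts `Zᵢ ×_S Zⱼ` cover the self-product, the diagonal restricts over them to
`Δ_{Z₁/S}`, `Δ_{Z₂/S}`, the graph and its transpose, and being a closed immersion is
Zariski-local on the target. [cite: Conrad2007, Introduction (p. 3 of the author's version)] -/
theorem isSeparated_iff_isClosedImmersion_graph [IsSeparated (pushout.inl f g ≫ p)]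
    [IsSeparated (pushout.inr f g ≫ p)] :
    IsSeparated p ↔ IsClosedImmersion (pushoutGraph f g p) := by
  haveI := Limits.isOpenImmersion_inl f g
  haveI := Limits.isOpenImmersion_inr f g
  haveI := isIso_pullbackLift_inl_inr f g
  haveI := isIso_pullbackLift_inr_inl f g
  constructor
  · intro hp
    -- the graph is (isomorphic to) a base change of the diagonal of `p`
    have H := pullback_map_diagonal_isPullback (pushout.inl f g) (pushout.inr f g) p
    have h₁ : IsClosedImmersion (pushoutDiagonalChart f g p (pushout.inl f g) (pushout.inr f g)) :=
      MorphismProperty.of_isPullback H hp.isClosedImmersion_diagonal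
    rw [← pullbackLift_pushoutDiagonalChart]
    infer_instance
  · intro hΓ
    -- the open cover of `(Z₁ ⨿_W Z₂) ×_S (Z₁ ⨿_W Z₂)` by the four charts `Zᵢ ×_S Zⱼ`
    let obj : Bool × Bool → Scheme.{u}
      | (true, true) => pullback (pushout.inl f g ≫ p) (pushout.inl f g ≫ p)
      | (true, false) => pullback (pushout.inl f g ≫ p) (pushout.inr f g ≫ p)
      | (false, true) => pullback (pushout.inr f g ≫ p) (pushout.inl f g ≫ p)
      | (false, false) => pullback (pushout.inr f g ≫ p) (pushout.inr f g ≫ p)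
    let map : ∀ ij : Bool × Bool, obj ij ⟶ pullback p p
      | (true, true) => pushoutChart f g p (pushout.inl f g) (pushout.inl f g)
      | (true, false) => pushoutChart f g p (pushout.inl f g) (pushout.inr f g)
      | (false, true) => pushoutChart f g p (pushout.inr f g) (pushout.inl f g)
      | (false, false) => pushoutChart f g p (pushout.inr f g) (pushout.inr f g)
    have hmap : ∀ ij, IsOpenImmersion (map ij) := by
      rintro ⟨_ | _, _ | _⟩ <;> exact Scheme.pullback_map_isOpenImmersion _ _ _ _ _ _ _ _ _
    have hcov : ∀ x : ↑(pullback p p), ∃ ij y, map ij y = x := by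
      intro x
      rcases exists_pushoutChart_eq f g p x with h | h | h | h
      · exact ⟨(true, true), h⟩
      · exact ⟨(true, false), h⟩
      · exact ⟨(false, true), h⟩
      · exact ⟨(false, false), h⟩
    let 𝒰 : (pullback p p).OpenCover := Scheme.Cover.mkOfCovers (Bool × Bool) obj map hcov hmap
    refine ⟨IsZariskiLocalAtTarget.of_openCover 𝒰 ?_⟩
    rintro ⟨_ | _, _ | _⟩
    · -- chart `Z₂ ×_S Z₂`: the diagonal of the separated `Z₂ → S`
      change IsClosedImmersion (pullback.snd (pullback.diagonal p)
        (pushoutChart f g p (pushout.inr f g) (pushout.inr f g)))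
      rw [isClosedImmersion_pullbackSnd_diagonal_chart_iff, pushoutDiagonalChart_self]
      infer_instance
    · -- chart `Z₂ ×_S Z₁`: the transposed graph
      change IsClosedImmersion (pullback.snd (pullback.diagonal p)
        (pushoutChart f g p (pushout.inr f g) (pushout.inl f g)))
      rw [isClosedImmersion_pullbackSnd_diagonal_chart_iff,
        ← MorphismProperty.cancel_left_of_respectsIso @IsClosedImmersion
          (pullback.lift g f pushout.condition.symm), pullbackLift_pushoutDiagonalChart']
      infer_instance
    · -- chart `Z₁ ×_S Z₂`: the graph
      change IsClosedImmersion (pullback.snd (pullback.diagonal p)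
        (pushoutChart f g p (pushout.inl f g) (pushout.inr f g)))
      rw [isClosedImmersion_pullbackSnd_diagonal_chart_iff,
        ← MorphismProperty.cancel_left_of_respectsIso @IsClosedImmersion
          (pullback.lift f g pushout.condition), pullbackLift_pushoutDiagonalChart]
      exact hΓ
    · -- chart `Z₁ ×_S Z₁`: the diagonal of the separated `Z₁ → S`
      change IsClosedImmersion (pullback.snd (pullback.diagonal p)
        (pushoutChart f g p (pushout.inl f g) (pushout.inl f g)))
      rw [isClosedImmersion_pullbackSnd_diagonal_chart_iff, pushoutDiagonalChart_self]
      infer_instance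

/-- **Conrad's gluing criterion for separatedness**, as printed: for `p : Z₁ ⨿_W Z₂ → S` whose
restrictions to the two charts are separated, `p` is separated iff the graph `W → Z₁ ×_S Z₂` of
the gluing has closed image. [cite: Conrad2007, Introduction (p. 3 of the author's version)] -/
theorem isSeparated_iff_isClosed_range_graph [IsSeparated (pushout.inl f g ≫ p)]
    [IsSeparated (pushout.inr f g ≫ p)] :
    IsSeparated p ↔ IsClosed (Set.range (pushoutGraph f g p)) := by
  rw [isSeparated_iff_isClosedImmersion_graph]
  exact isClosedImmersion_pullbackLift_iff_isClosed_range f g _ _ _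

end Criterion

/-! ## The criterion for `pushout.desc` -/

section Desc

variable {S : Scheme.{u}} (p₁ : Z₁ ⟶ S) (p₂ : Z₂ ⟶ S) (w : f ≫ p₁ = g ≫ p₂)

/-- **Conrad's criterion for the glued morphism `pushout.desc p₁ p₂`**: if `p₁ : Z₁ → S` and
`p₂ : Z₂ → S` are separated and agree on `W`, the glued morphism `Z₁ ⨿_W Z₂ → S` is separated
iff the graph `(f, g)_S : W → Z₁ ×_S Z₂` is a closed immersion.
[cite: Conrad2007, Introduction (p. 3 of the author's version)] -/
theorem isSeparated_pushoutDesc_iff [IsSeparated p₁] [IsSeparated p₂] :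
    IsSeparated (pushout.desc p₁ p₂ w) ↔ IsClosedImmersion (pullback.lift f g w) := by
  haveI : IsSeparated (pushout.inl f g ≫ pushout.desc p₁ p₂ w) := by
    rw [pushout.inl_desc]; infer_instance
  haveI : IsSeparated (pushout.inr f g ≫ pushout.desc p₁ p₂ w) := by
    rw [pushout.inr_desc]; infer_instance
  rw [isSeparated_iff_isClosedImmersion_graph]
  -- transport the graph along `Z₁ ×_S Z₂ ≅ Z₁ ×_S Z₂` (the two descriptions of the structure maps)
  have e : pushoutGraph f g (pushout.desc p₁ p₂ w) ≫
      (pullback.congrHom (pushout.inl_desc p₁ p₂ w) (pushout.inr_desc p₁ p₂ w)).hom =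
        pullback.lift f g w := by
    ext <;> simp
  rw [← e, MorphismProperty.cancel_right_of_respectsIso @IsClosedImmersion]

/-- The same with the closed-image formulation of the printed text.
[cite: Conrad2007, Introduction (p. 3 of the author's version)] -/
theorem isSeparated_pushoutDesc_iff_isClosed_range [IsSeparated p₁] [IsSeparated p₂] :
    IsSeparated (pushout.desc p₁ p₂ w) ↔
      IsClosed (Set.range (pullback.lift f g w : W ⟶ pullback p₁ p₂)) := by
  rw [isSeparated_pushoutDesc_iff, isClosedImmersion_pullbackLift_iff_isClosed_range]

/-- In particular: gluing two separated `S`-schemes along an open whose graph in `Z₁ ×_S Z₂` is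
closed yields a separated `S`-scheme. [cite: Conrad2007, Introduction (p. 3 of the author's version)] -/
theorem isSeparated_pushoutDesc [IsSeparated p₁] [IsSeparated p₂]
    (h : IsClosed (Set.range (pullback.lift f g w : W ⟶ pullback p₁ p₂))) :
    IsSeparated (pushout.desc p₁ p₂ w) :=
  (isSeparated_pushoutDesc_iff_isClosed_range f g p₁ p₂ w).mpr h

end Desc

end Literature.AlgebraicGeometry.Morphisms

end
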